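import Summits.Parity.GeneralizedHardyLittlewood.Theorems.PrimeLevelFamEdgeMomentsBeyondDiagonalDiagDecorM4Coprime
import Summits.Parity.GeneralizedHardyLittlewood.Theorems.PrimeLevelFamEdgeMomentsBeyondDiagonalDiagDecorMasterInputsLog
import HarnessLib

/-!
# Route `PrimeLevelFamEdge`, crux K_A `MomentsBeyondDiagonal` (stmt-Parity-20007), line «petersson_layers» v4, stub `stub_diag`:
# **the `M₄`-decorated shifted Selberg COORDINATE is `O(D(n)(1+κ(n))·log^{r+1}M)`** — the profile layer over
# `…DiagDecorM4Coprime.abs_coprimeSumPow_M4_le`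

The `M₄ = τ(3P₂² − 2P₄)`-engine asked for by rung 2 of `stub_diag` (`…DiagRungTwoOfM4`), penultimate layer: the decorated
shifted coordinate of `…DiagDecorShiftedBlockDecorSel` for the decoration `D = 3P₂² − 2P₄`,
`T_D^{[r]}(M;n) = Σ_c P_c·(Σ_{k≤M/n,(k,n)=1} W(k)τ(k)D(k)·log^{c+r}((M/n)/k))/logᶜM`, has NO main term and the crude size

* `abs_shiftedCoordM4_le` — **`|T_D^{[r]}(M;n)| ≤ K·D(n)(1+κ(n))·log^{r+1}M`** (`P₀ = P₁ = 0`, `M ≥ 3`, `1 ≤ n ≤ M`; from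
  `abs_coprimeSumPow_M4_le` at `y = M/n`, `(1+log(M/n))^{c+r+1} ≤ (2 log M)^{c+r+1}`),

one logarithm ABOVE the format `K₁D(n)log^{r}M/log^sM` (`s = 0`) of the crude hypothesis `hb₁` of
`…DiagDecorShiftedBlockDecor.abs_collapseShiftedDecor_logPow_le` and with the extra harmonic weight `(1+κ(n))`. What remains of
(M4) (`…DiagDecorOrderTwoTwoPoly.orderTwoTwoPoly_of_M4`) is therefore the last, purely book-keeping layer: the block expansion
`…ShiftedBlockDecorSel.selbergBlockDecor_expand` summed with absolute values over `(c, g)` against this coordinate size (for ALL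
`t ≥ 0`, including the `t = 0` piece, since there is no main term), i.e. the `(1+κ)`-weighted, `log^{+1}`-tolerant twin of
`abs_collapseShiftedDecor_logPow_le`; then `L = 2B + ℓ⁺₁ + ℓ⁺₂` for `m ≤ 1` as in `…ShiftedP2Lpow.tauP2Tau_Lpow_eq_sum_blocks`.
Def-free; theorems only. Helper `--supports stmt-Parity-20007`; closes nothing; K_A, K_B and the Parity summit are NOT proved;
nothing about Landau–Siegel zeros.

## References
* E. Kowalski, P. Michel, J. VanderKam, J. reine angew. Math. 526 (2000), (23)–(28) pp. 13–15 and Prop. 5.1 p. 18.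
  [cite: KowalskiMichelVanderKam2000, (23)–(28) — derivation (fourth central divisor-log moment of the Selberg coordinates)]
-/

noncomputable section

open scoped Real
open Finset ArithmeticFunction Polynomial

namespace Summit.Parity.GeneralizedHardyLittlewood.Theorems.MomentsBeyondDiagonal.DiagKernel

open Literature.NumberTheory.LFunctions Literature.NumberTheory.LFunctions.KMV2000
open MollifierMainTerm (W)
open SelbergCoord (kappa)
open Literature.NumberTheory.Sieve (one_le_log_of_three_le)
open Summit.Parity.GeneralizedHardyLittlewood.Theorems.BeyondDiagonalBeatsQuarter.KernelFormXSq
  (copTauW copTauW_apply mainConst divWeight divWeight_nonneg)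

/-- The bridge `W(k)[(k,n)=1]·(τ(k)·X) = a_n(k)·X`. [folklore] -/
theorem copW_mul_card_mul_eq (n k : ℕ) (X : ℝ) :
    (if k.Coprime n then W k else 0) * ((k.divisors.card : ℝ) * X) = copTauW n k * X := by
  rw [copTauW_apply]
  split_ifs <;> ring

/-- **The `M₄`-decorated shifted coordinate is `O(D(n)(1+κ(n))log^{r+1}M)`** (`P₀ = P₁ = 0`; for every `r` there is `K ≥ 0`
with the bound for all `M ≥ 3`, `1 ≤ n ≤ M`). [cite: KowalskiMichelVanderKam2000, (23)–(28) — derivation] -/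
theorem abs_shiftedCoordM4_le (P : ℝ[X]) (hP0 : P.coeff 0 = 0) (hP1 : P.coeff 1 = 0) (r : ℕ) :
    ∃ K : ℝ, 0 ≤ K ∧ ∀ M : ℝ, 3 ≤ M → ∀ n : ℕ, n ≠ 0 → (n : ℝ) ≤ M →
      |∑ c ∈ Finset.range (P.natDegree + 1), P.coeff c *
          ((∑ k ∈ Icc 1 ⌊M / n⌋₊, (if k.Coprime n then W k else 0) *
              ((k.divisors.card : ℝ) *
                (3 * (∑ p ∈ k.primeFactors, Real.log p ^ 2) ^ 2 - 2 * ∑ p ∈ k.primeFactors, Real.log p ^ 4)) *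
            Real.log (M / n / k) ^ (c + r)) / Real.log M ^ c)| ≤
        K * divWeight n * (1 + kappa n) * Real.log M ^ (r + 1) := by
  -- one engine constant per `c ≥ 2`
  have hex : ∀ c : ℕ, ∃ C : ℝ, 0 < C ∧ (2 ≤ c → ∀ n : ℕ, n ≠ 0 → ∀ y : ℝ, 1 ≤ y →
      |∑ k ∈ Icc 1 ⌊y⌋₊, copTauW n k * Real.log (y / k) ^ (c + r) *
          (3 * (∑ p ∈ k.primeFactors, Real.log p ^ 2) ^ 2 - 2 * ∑ p ∈ k.primeFactors, Real.log p ^ 4)| ≤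
        C * divWeight n * (1 + kappa n) * (1 + Real.log y) ^ (c + r + 1)) := by
    intro c
    by_cases hc : 2 ≤ c
    · obtain ⟨C, hC, h⟩ := abs_coprimeSumPow_M4_le (show 2 ≤ c + r by omega)
      exact ⟨C, hC, fun _ ↦ h⟩
    · exact ⟨1, one_pos, fun h ↦ absurd h hc⟩
  choose Cc hCc0 hCc using hex
  set K : ℝ := ∑ c ∈ Finset.range (P.natDegree + 1), |P.coeff c| * Cc c * 2 ^ (c + r + 1) with hK
  have hK0 : 0 ≤ K := Finset.sum_nonneg fun c _ ↦ by have := hCc0 c; positivity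
  refine ⟨K, hK0, fun M hM n hn hnM ↦ ?_⟩
  set ℓ := Real.log M with hℓ
  have hℓ1 : 1 ≤ ℓ := one_le_log_of_three_le hM
  have hℓ0 : 0 < ℓ := by linarith
  have hD := divWeight_nonneg n
  have hκ : 0 ≤ kappa n := by
    unfold kappa
    exact Finset.sum_nonneg fun p hp ↦ by
      have hp2 : (2 : ℝ) ≤ p := by exact_mod_cast (Nat.prime_of_mem_primeFactors hp).two_le
      exact div_nonneg (Real.log_nonneg (by linarith)) (by linarith)
  obtain ⟨hY0, hYℓ⟩ := log_div_nonneg_and_le hM hn hnM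
  have hn0 : (0 : ℝ) < n := by exact_mod_cast Nat.pos_of_ne_zero hn
  have hy1 : 1 ≤ M / n := (one_le_div hn0).2 hnM
  -- termwise
  have hterm : ∀ c ∈ Finset.range (P.natDegree + 1),
      |P.coeff c * ((∑ k ∈ Icc 1 ⌊M / n⌋₊, (if k.Coprime n then W k else 0) *
          ((k.divisors.card : ℝ) *
            (3 * (∑ p ∈ k.primeFactors, Real.log p ^ 2) ^ 2 - 2 * ∑ p ∈ k.primeFactors, Real.log p ^ 4)) *
          Real.log (M / n / k) ^ (c + r)) / ℓ ^ c)| ≤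
        |P.coeff c| * Cc c * 2 ^ (c + r + 1) * (divWeight n * (1 + kappa n) * ℓ ^ (r + 1)) := by
    intro c _
    by_cases hPc : P.coeff c = 0
    · rw [hPc, zero_mul, abs_zero]
      simp
    · have hc2 : 2 ≤ c := by
        rcases Nat.lt_or_ge c 2 with h | h
        · interval_cases c
          · exact absurd hP0 hPc
          · exact absurd hP1 hPc
        · exact h
      have hre : ∑ k ∈ Icc 1 ⌊M / n⌋₊, (if k.Coprime n then W k else 0) *
            ((k.divisors.card : ℝ) *
              (3 * (∑ p ∈ k.primeFactors, Real.log p ^ 2) ^ 2 - 2 * ∑ p ∈ k.primeFactors, Real.log p ^ 4)) *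
            Real.log (M / n / k) ^ (c + r) =
          ∑ k ∈ Icc 1 ⌊M / n⌋₊, copTauW n k * Real.log (M / n / k) ^ (c + r) *
            (3 * (∑ p ∈ k.primeFactors, Real.log p ^ 2) ^ 2 - 2 * ∑ p ∈ k.primeFactors, Real.log p ^ 4) :=
        Finset.sum_congr rfl fun k _ ↦ by rw [copW_mul_card_mul_eq]; ring
      have hS := hCc c hc2 n hn (M / n) hy1
      rw [← hre] at hS
      have h2ℓ : (1 + Real.log (M / n)) ^ (c + r + 1) ≤ (2 * ℓ) ^ (c + r + 1) :=
        pow_le_pow_left₀ (by linarith) (by linarith) _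
      rw [abs_mul, abs_div, abs_of_pos (pow_pos hℓ0 c)]
      have hCc := hCc0 c
      have hB := hS.trans (show Cc c * divWeight n * (1 + kappa n) * (1 + Real.log (M / n)) ^ (c + r + 1) ≤
          (Cc c * 2 ^ (c + r + 1) * (divWeight n * (1 + kappa n) * ℓ ^ (r + 1))) * ℓ ^ c from by
        calc Cc c * divWeight n * (1 + kappa n) * (1 + Real.log (M / n)) ^ (c + r + 1)
            ≤ Cc c * divWeight n * (1 + kappa n) * (2 * ℓ) ^ (c + r + 1) := by gcongr
          _ = (Cc c * 2 ^ (c + r + 1) * (divWeight n * (1 + kappa n) * ℓ ^ (r + 1))) * ℓ ^ c := by ring)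
      have hB' := (div_le_iff₀ (pow_pos hℓ0 c)).2 hB
      calc _ ≤ |P.coeff c| * (Cc c * 2 ^ (c + r + 1) * (divWeight n * (1 + kappa n) * ℓ ^ (r + 1))) :=
            mul_le_mul_of_nonneg_left hB' (abs_nonneg _)
        _ = _ := by ring
  calc _ ≤ ∑ c ∈ Finset.range (P.natDegree + 1), |P.coeff c * ((∑ k ∈ Icc 1 ⌊M / n⌋₊, (if k.Coprime n then W k else 0) *
          ((k.divisors.card : ℝ) *
            (3 * (∑ p ∈ k.primeFactors, Real.log p ^ 2) ^ 2 - 2 * ∑ p ∈ k.primeFactors, Real.log p ^ 4)) *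
          Real.log (M / n / k) ^ (c + r)) / ℓ ^ c)| := Finset.abs_sum_le_sum_abs _ _
    _ ≤ ∑ c ∈ Finset.range (P.natDegree + 1), |P.coeff c| * Cc c * 2 ^ (c + r + 1) *
          (divWeight n * (1 + kappa n) * ℓ ^ (r + 1)) := Finset.sum_le_sum hterm
    _ = K * divWeight n * (1 + kappa n) * ℓ ^ (r + 1) := by
        rw [hK, Finset.sum_mul, Finset.sum_mul, Finset.sum_mul]
        exact Finset.sum_congr rfl fun c _ ↦ by ring

end Summit.Parity.GeneralizedHardyLittlewood.Theorems.MomentsBeyondDiagonal.DiagKernel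

end
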